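import Literature.NumberTheory.DiophantineGeometry.GenEllValuationMultiplicity
import Mathlib.Algebra.Polynomial.Derivative
import Mathlib.RingTheory.Valuation.Integers
import Mathlib.Tactic.LinearCombination
import HarnessLib
/-!
# [GenEll] Thm. 2.1 on the `D_e` route: plane model of `t` and the SHARP conductor inequality at
# primes of good reduction

S. Mochizuki, *Arithmetic elliptic curves in general position*, Math. J. Okayama Univ. 52 (2010),
Prop. 1.6 p. 10 "(Conductor Bounded by the Height)" for a REDUCED divisor, as used in the proof of
Thm. 2.1 pp. 12–13 (corrections of the author's 2016 Comments) [cite: MochizukiGenEll2010, Prop 1.6 p.10].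
Classical and undisputed; support file (package W4b/W5 (A)+(C), holder abc-iut-w5-d045, of abc-iut-S6's
GENELLTWO-P1ROUTE note) for the route item `GenEllTwo` (stmt-ABC-19679); nothing here bears on
[IUTchIII] Cor. 3.12.

SETTING (`e = 2k+1`). The cyclic cover `D_e : r^e = x(1−x)` of `ℙ¹_x`, `s := 1 − 2x` (`s² = 1 − 4r^e`),
the function `t := 1/r + r^{k+1}/s = (s + r^{k+2})/(r s)` (simple poles at the special points), and
`N := r² s³ · dt/dr = −s³ + (k+1) r^{k+2} − 2 r^{3k+3}` cutting out the ramification of `t` on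
`U = {rs ≠ 0}`. Everything is DEFINITION-FREE: a point of `U` over a field `K` is `(r, s, t)` with
`hcurve : s² = 1 − 4r^{2k+1}`, `ht : t·(r·s) = s + r^{k+2}`; `hN : N = …`; and the FIBRE POLYNOMIAL of
`t` over a value `b`, `G_b(X) = X^{2k+4} + 4b²X^{2k+3} − 8bX^{2k+2} + 4X^{2k+1} − b²X² + 2bX − 1` (the
monic form of `(bX − 1)²(1 − 4X^e) − X^{e+3}`; its roots are the `r`-coordinates of `t⁻¹(b)` with the
ramification indices as multiplicities), is a polynomial `g` with `hg : g = …`.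

CONTENTS. (A) plane-model identities (`ring`/`linear_combination`): `De.planeModel_eq_zero`
(`G_t(r) = 0`), `De.fiber_sub_fiber`, `De.Gt_eq` (`∂G/∂t = −2r^{k+3}s`), `De.sq_mul_Gr_eq`
(**`r²s³·G'_t(r) = 2r^{k+3}s·N`**, the algebraic shadow of `G_r + G_t·dt/dr = 0`, from an explicit
derivation identity). The fibre polynomial: `De.fiber_monic`, `De.eval_fiber`,
`De.eval_derivative_fiber`, `De.valuation_coeff_fiber_le_one`. (C) at a place `v` with `v 2 = 1`:
`De.valuation_r_eq_one`, `De.valuation_s_eq_one` and the **sharp inequality**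
`De.valuation_sub_lt_valuation_N`: if `G_b` has GOOD REDUCTION at `v` (splits; roots pairwise
distinct mod `v`; tame multiplicities), `v (t − b) < 1` and `N ≠ 0`, then `v (t − b) < v N`, i.e.
`ord_v (t(P) − b) ≥ ord_v N(P) + 1` (a point reducing onto a point `Q` of the fibre meets it with
multiplicity `e_Q·d` and the ramification divisor with `(e_Q − 1)·d`, `d ≥ 1`). With the separation
of values this is the per-place input of the summation `log-cond_{E_red} ≲ |B|·h(t) − h(N)` of
GENELLTWO-P1ROUTE §3 (d); the converse («`v N < 1` ⇒ `t` meets a critical value», package W5c,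
abc-iut-w5-d059) enters `De.good_place_dichotomy` as a hypothesis.
-/

noncomputable section

namespace Literature.NumberTheory.DiophantineGeometry.GenEll

open _root_.Polynomial

/-! ## (A) The plane model of `t` on `D_e` -/

section PlaneModel

variable {K : Type*} [CommRing K] (k : ℕ)

/-- The plane-model relation: on `D_e` (`s² = 1 − 4r^{2k+1}`) with `t·(r s) = s + r^{k+2}`, the
`r`-coordinate is a root of the fibre polynomial `G_t`, i.e.
`r^{2k+4} + 4t² r^{2k+3} − 8t r^{2k+2} + 4r^{2k+1} − t² r² + 2t r − 1 = 0`
(from `((rt−1)s)² = r^{2k+4}`). [cite: MochizukiGenEll2010, Prop 1.6 p.10] -/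
theorem De.planeModel_eq_zero {r s t : K} (hcurve : s ^ 2 = 1 - 4 * r ^ (2 * k + 1))
    (ht : t * (r * s) = s + r ^ (k + 2)) :
    r ^ (2 * k + 4) + 4 * t ^ 2 * r ^ (2 * k + 3) - 8 * t * r ^ (2 * k + 2) + 4 * r ^ (2 * k + 1)
      - t ^ 2 * r ^ 2 + 2 * t * r - 1 = 0 := by
  linear_combination (-((r * t - 1) * s + r ^ (k + 2))) * ht + (r * t - 1) ^ 2 * hcurve

/-- Difference of two fibre polynomials at the same argument:
`G_b(r) − G_c(r) = (b − c)·r·(1 − 4r^{2k+1})·(2 − (b+c)·r)`. [cite: MochizukiGenEll2010, Prop 1.6 p.10] -/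
theorem De.fiber_sub_fiber (r b c : K) :
    (r ^ (2 * k + 4) + 4 * b ^ 2 * r ^ (2 * k + 3) - 8 * b * r ^ (2 * k + 2) + 4 * r ^ (2 * k + 1)
        - b ^ 2 * r ^ 2 + 2 * b * r - 1) -
      (r ^ (2 * k + 4) + 4 * c ^ 2 * r ^ (2 * k + 3) - 8 * c * r ^ (2 * k + 2) + 4 * r ^ (2 * k + 1)
        - c ^ 2 * r ^ 2 + 2 * c * r - 1) =
      (b - c) * r * (1 - 4 * r ^ (2 * k + 1)) * (2 - (b + c) * r) := by
  ring

/-- The `t`-partial derivative of the plane model on the curve: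
`∂G/∂t (t, r) = 8t r^{2k+3} − 8 r^{2k+2} − 2t r² + 2r = −2 r^{k+3} s`. [cite: MochizukiGenEll2010, Prop 1.6 p.10] -/
theorem De.Gt_eq {r s t : K} (hcurve : s ^ 2 = 1 - 4 * r ^ (2 * k + 1))
    (ht : t * (r * s) = s + r ^ (k + 2)) :
    8 * t * r ^ (2 * k + 3) - 8 * r ^ (2 * k + 2) - 2 * t * r ^ 2 + 2 * r = -2 * r ^ (k + 3) * s := by
  linear_combination (-2 * r * s) * ht + (-2 * r * (1 - r * t)) * hcurve

/-- **`r² s³ · G'_t(r) = 2 r^{k+3} s · N` on `D_e`**, where `G'_t = ∂G/∂r` and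
`N = −s³ + (k+1) r^{k+2} − 2r^{3k+3}` (`= r² s³ · dt/dr`): the algebraic form of
`∂G/∂r + ∂G/∂t · dt/dr = 0` along the curve, via the derivation
`r²s³ ∂_r − 2(2k+1) r^{2k+2} s² ∂_s + N ∂_t`, which kills both defining equations.
[cite: MochizukiGenEll2010, Prop 1.6 p.10] -/
theorem De.sq_mul_Gr_eq {r s t N : K} (hcurve : s ^ 2 = 1 - 4 * r ^ (2 * k + 1))
    (ht : t * (r * s) = s + r ^ (k + 2)) (hN : N = -s ^ 3 + (k + 1) * r ^ (k + 2) - 2 * r ^ (3 * k + 3)) :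
    r ^ 2 * s ^ 3 * ((2 * k + 4) * r ^ (2 * k + 3) + 4 * (2 * k + 3) * t ^ 2 * r ^ (2 * k + 2)
        - 8 * (2 * k + 2) * t * r ^ (2 * k + 1) + 4 * (2 * k + 1) * r ^ (2 * k) - 2 * t ^ 2 * r + 2 * t)
      = 2 * r ^ (k + 3) * s * N := by
  have hD : r ^ 2 * s ^ 3 * (t * s - (k + 2) * r ^ (k + 1))
      - 2 * (2 * k + 1) * r ^ (2 * k + 2) * s ^ 2 * (r * t - 1) + N * (r * s) = 0 := by
    linear_combination (r * s ^ 3 - 2 * (2 * k + 1) * r ^ (2 * k + 2) * s) * ht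
      - ((k + 1) * r ^ (k + 3) * s) * hcurve + (r * s) * hN
  have hGt := De.Gt_eq k hcurve ht
  linear_combination (-N) * hGt + (-((r * t - 1) * s + r ^ (k + 2))) * hD
    + (-(r ^ 2 * s ^ 3 * (t * s + (k + 2) * r ^ (k + 1))
        - 2 * (2 * k + 1) * r ^ (2 * k + 2) * s ^ 2 * (r * t - 1) + N * (r * s))) * ht
    + (2 * r ^ 2 * s ^ 3 * t * (r * t - 1) + 2 * N * r * (r * t - 1)) * hcurve

end PlaneModel

/-! ## The fibre polynomial `G_b` -/

section Fiber

variable {K : Type*} [Field K] (k : ℕ)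

/-- The fibre polynomial is monic (of degree `2k+4 = e+3 = deg t`). [cite: MochizukiGenEll2010, Prop 1.6 p.10] -/
theorem De.fiber_monic (b : K) {g : K[X]}
    (hg : g = X ^ (2 * k + 4) + C (4 * b ^ 2) * X ^ (2 * k + 3) - C (8 * b) * X ^ (2 * k + 2)
      + C 4 * X ^ (2 * k + 1) - C (b ^ 2) * X ^ 2 + C (2 * b) * X - 1) : g.Monic := by
  have h : (C (4 * b ^ 2) * X ^ (2 * k + 3) - C (8 * b) * X ^ (2 * k + 2)
      + C 4 * X ^ (2 * k + 1) - C (b ^ 2) * X ^ 2 + C (2 * b) * X - 1 : K[X]).degree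
        < (2 * k + 4 : ℕ) := by
    have h4 : ((2 * k + 3 : ℕ) : WithBot ℕ) < (2 * k + 4 : ℕ) := by exact_mod_cast (by omega)
    refine lt_of_le_of_lt ?_ h4
    refine (degree_sub_le _ _).trans (max_le ?_ ?_)
    · refine (degree_add_le _ _).trans (max_le ?_ ?_)
      · refine (degree_sub_le _ _).trans (max_le ?_ ?_)
        · refine (degree_add_le _ _).trans (max_le ?_ ?_)
          · refine (degree_sub_le _ _).trans (max_le ?_ ?_)
            · exact degree_C_mul_X_pow_le _ _
            · exact (degree_C_mul_X_pow_le _ _).trans (by exact_mod_cast (by omega))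
          · exact (degree_C_mul_X_pow_le _ _).trans (by exact_mod_cast (by omega))
        · exact (degree_C_mul_X_pow_le _ _).trans (by exact_mod_cast (by omega))
      · exact (degree_C_mul_X_le _).trans (by exact_mod_cast (by omega))
    · exact degree_one_le.trans (by exact_mod_cast (by omega))
  have h' : g = X ^ (2 * k + 4) + (C (4 * b ^ 2) * X ^ (2 * k + 3) - C (8 * b) * X ^ (2 * k + 2)
      + C 4 * X ^ (2 * k + 1) - C (b ^ 2) * X ^ 2 + C (2 * b) * X - 1) := by rw [hg]; ring
  rw [h']
  exact (monic_X_pow _).add_of_left (by rwa [degree_X_pow])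

/-- The value of the fibre polynomial. [cite: MochizukiGenEll2010, Prop 1.6 p.10] -/
theorem De.eval_fiber (b : K) {g : K[X]}
    (hg : g = X ^ (2 * k + 4) + C (4 * b ^ 2) * X ^ (2 * k + 3) - C (8 * b) * X ^ (2 * k + 2)
      + C 4 * X ^ (2 * k + 1) - C (b ^ 2) * X ^ 2 + C (2 * b) * X - 1) (x : K) :
    g.eval x = x ^ (2 * k + 4) + 4 * b ^ 2 * x ^ (2 * k + 3) - 8 * b * x ^ (2 * k + 2)
      + 4 * x ^ (2 * k + 1) - b ^ 2 * x ^ 2 + 2 * b * x - 1 := by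
  rw [hg]
  simp [eval_add, eval_sub, eval_mul, eval_pow, eval_X, eval_C]

/-- The value of the derivative of the fibre polynomial (`= ∂G/∂r (b, x)`).
[cite: MochizukiGenEll2010, Prop 1.6 p.10] -/
theorem De.eval_derivative_fiber (b : K) {g : K[X]}
    (hg : g = X ^ (2 * k + 4) + C (4 * b ^ 2) * X ^ (2 * k + 3) - C (8 * b) * X ^ (2 * k + 2)
      + C 4 * X ^ (2 * k + 1) - C (b ^ 2) * X ^ 2 + C (2 * b) * X - 1) (x : K) :
    (derivative g).eval x = (2 * k + 4) * x ^ (2 * k + 3) + 4 * (2 * k + 3) * b ^ 2 * x ^ (2 * k + 2)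
      - 8 * (2 * k + 2) * b * x ^ (2 * k + 1) + 4 * (2 * k + 1) * x ^ (2 * k)
      - 2 * b ^ 2 * x + 2 * b := by
  have e1 : 2 * k + 4 - 1 = 2 * k + 3 := by omega
  have e2 : 2 * k + 3 - 1 = 2 * k + 2 := by omega
  have e3 : 2 * k + 2 - 1 = 2 * k + 1 := by omega
  have e4 : 2 * k + 1 - 1 = 2 * k := by omega
  rw [hg]
  simp only [derivative_add, derivative_sub, derivative_mul, derivative_X_pow, derivative_C,
    derivative_X, derivative_one, zero_mul, zero_add, mul_one, e1, e2, e3, e4,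
    eval_add, eval_sub, eval_mul, eval_pow, eval_X, eval_C, sub_zero]
  push_cast
  ring

variable {Γ₀ : Type*} [LinearOrderedCommGroupWithZero Γ₀] (v : Valuation K Γ₀)

/-- For `v`-integral `b` the fibre polynomial has `v`-integral coefficients (it is the image of a
polynomial over the valuation ring). [cite: MochizukiGenEll2010, Prop 1.6 p.10] -/
theorem De.valuation_coeff_fiber_le_one {b : K} (hb : v b ≤ 1) {g : K[X]}
    (hg : g = X ^ (2 * k + 4) + C (4 * b ^ 2) * X ^ (2 * k + 3) - C (8 * b) * X ^ (2 * k + 2)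
      + C 4 * X ^ (2 * k + 1) - C (b ^ 2) * X ^ 2 + C (2 * b) * X - 1) (n : ℕ) :
    v (g.coeff n) ≤ 1 := by
  obtain ⟨b₀, hb₀⟩ : ∃ b₀ : v.integer, (b₀ : K) = b := ⟨⟨b, hb⟩, rfl⟩
  obtain ⟨g₀, hg₀⟩ : ∃ g₀ : (v.integer)[X], g₀ = X ^ (2 * k + 4) + C (4 * b₀ ^ 2) * X ^ (2 * k + 3)
      - C (8 * b₀) * X ^ (2 * k + 2) + C 4 * X ^ (2 * k + 1) - C (b₀ ^ 2) * X ^ 2 + C (2 * b₀) * X - 1 :=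
    ⟨_, rfl⟩
  have hmap : g = g₀.map v.integer.subtype := by
    rw [hg, hg₀, ← hb₀]
    simp [Polynomial.map_sub, Polynomial.map_add, Polynomial.map_mul, Polynomial.map_pow, map_ofNat]
  rw [hmap, coeff_map]
  exact (g₀.coeff n).2

end Fiber

/-! ## (C) Valuations at a point of `D_e` meeting an integral value of `t` -/

section GoodPlace

variable {K : Type*} [Field K] {Γ₀ : Type*} [LinearOrderedCommGroupWithZero Γ₀]
  (v : Valuation K Γ₀) (k : ℕ)

/-- If `v x ≤ 1`, `v y ≤ 1` and `x·y` is a `v`-unit then `x` is a `v`-unit. [cite: MochizukiGenEll2010, Prop 1.6 p.10] -/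
private theorem valuation_eq_one_of_mul {x y : K} (hx : v x ≤ 1) (hy : v y ≤ 1)
    (h : v (x * y) = 1) : v x = 1 := by
  refine le_antisymm hx ?_
  calc 1 = v x * v y := by rw [← map_mul, h]
    _ ≤ v x := mul_le_of_le_one_right' hy

/-- On `D_e`, if `v t ≤ 1` then `v r ≤ 1`: `r` is a root of the monic `v`-integral fibre polynomial
`G_t`. [cite: MochizukiGenEll2010, Prop 1.6 p.10] -/
theorem De.valuation_r_le_one {r s t : K} (hcurve : s ^ 2 = 1 - 4 * r ^ (2 * k + 1))
    (ht : t * (r * s) = s + r ^ (k + 2)) (htv : v t ≤ 1) : v r ≤ 1 := by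
  obtain ⟨g, hg⟩ : ∃ g : K[X], g = X ^ (2 * k + 4) + C (4 * t ^ 2) * X ^ (2 * k + 3)
      - C (8 * t) * X ^ (2 * k + 2) + C 4 * X ^ (2 * k + 1) - C (t ^ 2) * X ^ 2 + C (2 * t) * X - 1 :=
    ⟨_, rfl⟩
  refine valuation_le_one_of_isRoot v (De.valuation_coeff_fiber_le_one k v htv hg)
    (by rw [(De.fiber_monic k t hg).leadingCoeff, map_one]) ?_
  rw [IsRoot.def, De.eval_fiber k t hg]
  exact De.planeModel_eq_zero k hcurve ht

/-- On `D_e`, if `v t ≤ 1` then `r` is a `v`-unit (`G_t` has constant term `−1`).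
[cite: MochizukiGenEll2010, Prop 1.6 p.10] -/
theorem De.valuation_r_eq_one {r s t : K} (hcurve : s ^ 2 = 1 - 4 * r ^ (2 * k + 1))
    (ht : t * (r * s) = s + r ^ (k + 2)) (htv : v t ≤ 1) : v r = 1 := by
  have hr := De.valuation_r_le_one v k hcurve ht htv
  have hG := De.planeModel_eq_zero k hcurve ht
  -- `r · Q = 1` with `Q` integral
  have hQ : r * (r ^ (2 * k + 3) + 4 * t ^ 2 * r ^ (2 * k + 2) - 8 * t * r ^ (2 * k + 1)
      + 4 * r ^ (2 * k) - t ^ 2 * r + 2 * t) = 1 := by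
    linear_combination hG
  have hn : ∀ n : ℕ, v (n : K) ≤ 1 := fun n => (v.mem_integer_iff _).1 (natCast_mem v.integer n)
  have h4 : v (4 : K) ≤ 1 := by exact_mod_cast hn 4
  have h8 : v (8 : K) ≤ 1 := by exact_mod_cast hn 8
  have h2 : v (2 : K) ≤ 1 := by exact_mod_cast hn 2
  refine valuation_eq_one_of_mul v hr ?_ (by rw [hQ, map_one])
  refine v.map_add_le (v.map_sub_le (v.map_add_le (v.map_sub_le (v.map_add_le ?_ ?_) ?_) ?_) ?_) ?_
  · rw [map_pow]; exact pow_le_one' hr _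
  · rw [map_mul, map_mul, map_pow, map_pow]
    exact mul_le_one' (mul_le_one' h4 (pow_le_one' htv _)) (pow_le_one' hr _)
  · rw [map_mul, map_mul, map_pow]
    exact mul_le_one' (mul_le_one' h8 htv) (pow_le_one' hr _)
  · rw [map_mul, map_pow]
    exact mul_le_one' h4 (pow_le_one' hr _)
  · rw [map_mul, map_pow]
    exact mul_le_one' (pow_le_one' htv _) hr
  · rw [map_mul]
    exact mul_le_one' h2 htv

/-- On `D_e`, if `v t ≤ 1` then `s` and `r t − 1` are `v`-units (`(rt−1)·s = r^{k+2}` and `s` is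
integral). [cite: MochizukiGenEll2010, Prop 1.6 p.10] -/
theorem De.valuation_s_eq_one {r s t : K} (hcurve : s ^ 2 = 1 - 4 * r ^ (2 * k + 1))
    (ht : t * (r * s) = s + r ^ (k + 2)) (htv : v t ≤ 1) :
    v s = 1 ∧ v (r * t - 1) = 1 := by
  have hr := De.valuation_r_eq_one v k hcurve ht htv
  have h4 : v (4 : K) ≤ 1 := by
    exact_mod_cast (v.mem_integer_iff _).1 (natCast_mem v.integer 4)
  -- `s` is integral: `s² = 1 − 4r^e` is integral
  have hs2 : v (s ^ 2) ≤ 1 := by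
    rw [hcurve]
    refine v.map_sub_le (le_of_eq v.map_one) ?_
    rw [map_mul, map_pow]
    exact mul_le_one' h4 (pow_le_one' hr.le _)
  have hs : v s ≤ 1 := by
    by_contra h
    push Not at h
    have : 1 < v (s ^ 2) := by
      rw [map_pow, pow_two]
      exact one_lt_mul'' h h
    exact (lt_irrefl _) (this.trans_le hs2)
  have hrt : v (r * t - 1) ≤ 1 :=
    v.map_sub_le (by rw [map_mul]; exact mul_le_one' hr.le htv) (le_of_eq v.map_one)
  have hprod : (r * t - 1) * s = r ^ (k + 2) := by linear_combination ht
  have hunit : v ((r * t - 1) * s) = 1 := by rw [hprod, map_pow, hr, one_pow]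
  refine ⟨valuation_eq_one_of_mul v hs hrt (by rwa [mul_comm]), valuation_eq_one_of_mul v hrt hs hunit⟩

/-- Separation of the values: if `v (t − b) < 1` and `b`, `b'` are distinct modulo `v`
(`v (b − b') = 1`), then `t − b'` is a `v`-unit. [cite: MochizukiGenEll2010, Prop 1.6 p.10] -/
theorem De.valuation_sub_eq_one_of_ne {t b b' : K} (htb : v (t - b) < 1) (hbb' : v (b - b') = 1) :
    v (t - b') = 1 :=
  valuation_sub_eq_one_of_lt v htb hbb'

/-- **The sharp inequality at a good place** ([GenEll] Prop. 1.6 for the reduced divisor `t⁻¹(B)`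
on `D_e`, local form). Let `(r, s, t)` be a point of `D_e ∖ {rs = 0}` over a field `K` with a
valuation `v`, `v 2 = 1`, and `b` a `v`-integral value whose fibre polynomial `G_b` has good
reduction at `v` (splits in `K`; roots pairwise distinct modulo `v`; multiplicities `v`-units). If
`t` meets `b` at `v` (`v (t − b) < 1`) and `N = r²s³·dt/dr ≠ 0` at the point, then

  `v (t − b) < v N`   (i.e. `ord_v (t − b) ≥ ord_v N + 1` for discrete `v`).

Proof: `G_b(r) = (b − t)·r·s²·(2 − (b+t)r)` has valuation `v (t−b)`; the multiplicity-gap lemma gives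
`v (G_b(r)) < v (G_b'(r))`; `G_b'(r) ≡ G_t'(r)` to order `v (t−b)`; and `r²s³ G_t'(r) = 2r^{k+3} s N`.
[cite: MochizukiGenEll2010, Prop 1.6 p.10] -/
theorem De.valuation_sub_lt_valuation_N (hv2 : v 2 = 1) {r s t N b : K}
    (hcurve : s ^ 2 = 1 - 4 * r ^ (2 * k + 1)) (ht : t * (r * s) = s + r ^ (k + 2))
    (hN : N = -s ^ 3 + (k + 1) * r ^ (k + 2) - 2 * r ^ (3 * k + 3)) (hN0 : N ≠ 0)
    (hb : v b ≤ 1) {g : K[X]}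
    (hg : g = X ^ (2 * k + 4) + C (4 * b ^ 2) * X ^ (2 * k + 3) - C (8 * b) * X ^ (2 * k + 2)
      + C 4 * X ^ (2 * k + 1) - C (b ^ 2) * X ^ 2 + C (2 * b) * X - 1)
    (hsplit : g.Splits) (hsep : ∀ a ∈ g.roots, ∀ a' ∈ g.roots, a ≠ a' → v (a - a') = 1)
    (htame : ∀ a ∈ g.roots, v (g.rootMultiplicity a : K) = 1)
    (htb : v (t - b) < 1) : v (t - b) < v N := by
  by_cases htb0 : t - b = 0
  · rw [htb0, map_zero]
    exact zero_lt_iff.2 ((v.ne_zero_iff).2 hN0)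
  have htv : v t ≤ 1 := by
    have : t = (t - b) + b := by ring
    rw [this]
    exact v.map_add_le htb.le hb
  have hr := De.valuation_r_eq_one v k hcurve ht htv
  obtain ⟨hs, hrt⟩ := De.valuation_s_eq_one v k hcurve ht htv
  have hG := De.planeModel_eq_zero k hcurve ht
  -- the value `G_b(r) = (b − t)·r·(1−4r^e)·(2 − (b+t)r)`
  have hgr : g.eval r = (b - t) * r * (1 - 4 * r ^ (2 * k + 1)) * (2 - (b + t) * r) := by
    rw [De.eval_fiber k b hg]
    linear_combination De.fiber_sub_fiber k r b t + hG
  have hunit : v (2 - (b + t) * r) = 1 := by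
    have e : 2 - (b + t) * r = -(2 * (r * t - 1)) + (t - b) * r := by ring
    rw [e, v.map_add_eq_of_lt_left]
    · simp only [v.map_neg, map_mul, hv2, hrt, one_mul]
    · simp only [v.map_neg, map_mul, hv2, hrt, hr, mul_one]
      exact htb
  have hvg : v (g.eval r) = v (t - b) := by
    rw [hgr, map_mul, map_mul, map_mul, hunit, mul_one, ← hcurve, map_pow, hs, one_pow, mul_one,
      hr, mul_one, v.map_sub_swap]
  have hg0 : g.eval r ≠ 0 := by
    intro h0
    rw [h0, map_zero] at hvg
    exact htb0 ((v.zero_iff).1 hvg.symm)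
  have hint : ∀ a ∈ g.roots, v a ≤ 1 := fun a ha =>
    valuation_le_one_of_isRoot v (De.valuation_coeff_fiber_le_one k v hb hg)
      (by rw [(De.fiber_monic k b hg).leadingCoeff, map_one])
      ((mem_roots (De.fiber_monic k b hg).ne_zero).1 ha)
  -- the multiplicity gap: `v (G_b r) < v (G_b' r)`
  obtain ⟨-, hgap⟩ := valuation_eval_lt_valuation_eval_derivative v hsplit
    (by rw [(De.fiber_monic k b hg).leadingCoeff, map_one]) hint hsep htame hr.le hg0
    (by rw [hvg]; exact htb)
  rw [hvg, De.eval_derivative_fiber k b hg] at hgap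
  -- `G'_t(r) ≡ G'_b(r)` modulo `t − b`
  have hdiff : (2 * k + 4) * r ^ (2 * k + 3) + 4 * (2 * k + 3) * t ^ 2 * r ^ (2 * k + 2)
        - 8 * (2 * k + 2) * t * r ^ (2 * k + 1) + 4 * (2 * k + 1) * r ^ (2 * k) - 2 * t ^ 2 * r + 2 * t
      = ((2 * k + 4) * r ^ (2 * k + 3) + 4 * (2 * k + 3) * b ^ 2 * r ^ (2 * k + 2)
        - 8 * (2 * k + 2) * b * r ^ (2 * k + 1) + 4 * (2 * k + 1) * r ^ (2 * k) - 2 * b ^ 2 * r + 2 * b)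
        + (t - b) * (4 * (2 * k + 3) * (t + b) * r ^ (2 * k + 2) - 8 * (2 * k + 2) * r ^ (2 * k + 1)
          - 2 * (t + b) * r + 2) := by
    ring
  have hM : v (4 * (2 * k + 3) * (t + b) * r ^ (2 * k + 2) - 8 * (2 * k + 2) * r ^ (2 * k + 1)
      - 2 * (t + b) * r + 2) ≤ 1 := by
    have hn : ∀ n : ℕ, v (n : K) ≤ 1 := fun n => (v.mem_integer_iff _).1 (natCast_mem v.integer n)
    have h4 : v (4 : K) ≤ 1 := by exact_mod_cast hn 4
    have h8 : v (8 : K) ≤ 1 := by exact_mod_cast hn 8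
    have h2 : v (2 : K) ≤ 1 := by exact_mod_cast hn 2
    have h23 : v (2 * k + 3 : K) ≤ 1 := by exact_mod_cast hn (2 * k + 3)
    have h22 : v (2 * k + 2 : K) ≤ 1 := by exact_mod_cast hn (2 * k + 2)
    have htb' : v (t + b) ≤ 1 := v.map_add_le htv hb
    refine v.map_add_le (v.map_sub_le (v.map_sub_le ?_ ?_) ?_) h2
    · rw [map_mul, map_mul, map_mul, map_pow]
      exact mul_le_one' (mul_le_one' (mul_le_one' h4 h23) htb') (pow_le_one' hr.le _)
    · rw [map_mul, map_mul, map_pow]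
      exact mul_le_one' (mul_le_one' h8 h22) (pow_le_one' hr.le _)
    · rw [map_mul, map_mul]
      exact mul_le_one' (mul_le_one' h2 htb') hr.le
  have hGr : v ((2 * k + 4) * r ^ (2 * k + 3) + 4 * (2 * k + 3) * t ^ 2 * r ^ (2 * k + 2)
        - 8 * (2 * k + 2) * t * r ^ (2 * k + 1) + 4 * (2 * k + 1) * r ^ (2 * k) - 2 * t ^ 2 * r + 2 * t)
      = v ((2 * k + 4) * r ^ (2 * k + 3) + 4 * (2 * k + 3) * b ^ 2 * r ^ (2 * k + 2)
        - 8 * (2 * k + 2) * b * r ^ (2 * k + 1) + 4 * (2 * k + 1) * r ^ (2 * k) - 2 * b ^ 2 * r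
        + 2 * b) := by
    rw [hdiff, v.map_add_eq_of_lt_left]
    rw [map_mul]
    exact lt_of_le_of_lt (mul_le_of_le_one_right' hM) hgap
  have hkey := De.sq_mul_Gr_eq k hcurve ht hN
  have hvN : v ((2 * k + 4) * r ^ (2 * k + 3) + 4 * (2 * k + 3) * t ^ 2 * r ^ (2 * k + 2)
        - 8 * (2 * k + 2) * t * r ^ (2 * k + 1) + 4 * (2 * k + 1) * r ^ (2 * k) - 2 * t ^ 2 * r + 2 * t)
      = v N := by
    have h1 := congrArg v hkey
    rw [map_mul, map_mul, map_pow, map_pow, hr, hs, one_pow, one_pow, one_mul, one_mul] at h1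
    rw [h1, map_mul, map_mul, map_mul, hv2, map_pow, hr, one_pow, hs, mul_one, mul_one, one_mul]
  rw [← hvN, hGr]
  exact hgap

/-- **Dichotomy at a good place** (the per-place input of the conductor summation
`log-cond_{(t⁻¹B)_red}(P) ≤ Σ_b h(t(P) − b)-terms − h(N(P))-terms + O(1)` of GENELLTWO-P1ROUTE §3 (d)).
`B` is a finite set of `v`-integral values pairwise distinct modulo `v`, each with a good-reduction
fibre polynomial; `hconv` is the converse direction (package W5c: `v N < 1` forces `t` to meet `B`).
Then EITHER `t` meets exactly one `b ∈ B`, with `v (t − b) < v N` and all other `t − b'` units, OR `t`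
meets no `b ∈ B` and `N` is not small (`1 ≤ v N`). [cite: MochizukiGenEll2010, Prop 1.6 p.10] -/
theorem De.good_place_dichotomy (hv2 : v 2 = 1) {r s t N : K}
    (hcurve : s ^ 2 = 1 - 4 * r ^ (2 * k + 1)) (ht : t * (r * s) = s + r ^ (k + 2))
    (hN : N = -s ^ 3 + (k + 1) * r ^ (k + 2) - 2 * r ^ (3 * k + 3)) (hN0 : N ≠ 0)
    (B : Finset K) (hB : ∀ b ∈ B, v b ≤ 1) (hBsep : ∀ b ∈ B, ∀ b' ∈ B, b ≠ b' → v (b - b') = 1)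
    (g : K → K[X])
    (hg : ∀ b ∈ B, g b = X ^ (2 * k + 4) + C (4 * b ^ 2) * X ^ (2 * k + 3) - C (8 * b) * X ^ (2 * k + 2)
      + C 4 * X ^ (2 * k + 1) - C (b ^ 2) * X ^ 2 + C (2 * b) * X - 1)
    (hsplit : ∀ b ∈ B, (g b).Splits)
    (hsep : ∀ b ∈ B, ∀ a ∈ (g b).roots, ∀ a' ∈ (g b).roots, a ≠ a' → v (a - a') = 1)
    (htame : ∀ b ∈ B, ∀ a ∈ (g b).roots, v ((g b).rootMultiplicity a : K) = 1)
    (hconv : v N < 1 → ∃ b ∈ B, v (t - b) < 1) :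
    (∃ b ∈ B, v (t - b) < 1 ∧ v (t - b) < v N ∧ ∀ b' ∈ B, b' ≠ b → v (t - b') = 1) ∨
      ((∀ b ∈ B, 1 ≤ v (t - b)) ∧ 1 ≤ v N) := by
  by_cases h : ∃ b ∈ B, v (t - b) < 1
  · obtain ⟨b, hbB, htb⟩ := h
    refine Or.inl ⟨b, hbB, htb, ?_, fun b' hb' hne => ?_⟩
    · exact De.valuation_sub_lt_valuation_N v k hv2 hcurve ht hN hN0 (hB b hbB) (hg b hbB)
        (hsplit b hbB) (hsep b hbB) (htame b hbB) htb
    · exact De.valuation_sub_eq_one_of_ne v htb (hBsep b hbB b' hb' (Ne.symm hne))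
  · push Not at h
    refine Or.inr ⟨h, ?_⟩
    by_contra hN1
    push Not at hN1
    obtain ⟨b, hbB, htb⟩ := hconv hN1
    exact (lt_irrefl _) ((h b hbB).trans_lt htb)

end GoodPlace

end Literature.NumberTheory.DiophantineGeometry.GenEll
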